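import Literature.AlgebraicGeometry.HodgeTheory.ComplexTorusIntegralHodgeClassesKunnethProjectorsPolarizationFormula
import HarnessLib

/-!
# Künneth projectors and Künnemann's relation for a polarization of arbitrary type

Sequel of g34-#6 `ComplexTorusIntegralHodgeClassesKunnethProjectorsPolarizationFormula` (the case `Θ^{[g]} = [pt_X]`, principal polarizations).
Here `X` is a complex torus of dimension `g`, `Θ ∈ NS(X)` a divisor class with `Θ^{[g]} = D · [pt_X]` for some `D ∈ ℤ` — e.g. `Θ = −θ = c₁(L)` for a
polarization `θ` of type `(d₁, …, d_g)`, `D = d₁⋯d_g = χ(L)` (§4; EVERY nondegenerate Riemann form has a type) — `m(Θ) = μ^*Θ − p₁^*Θ − p₂^*Θ` the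
Mumford class and `π_0, …, π_{2g}` the integral Künneth projectors. The formal argument of g34-#6 goes through with the degree `D` carried along:

* §1 `zsmul_sum_pow_smul_kunnethProjector_eq_nsDivPower`, `…_eq_sum_sum`: `D · Σ_s nˢ π_s = ((pr₁ − n pr₂)^*Θ)^{[g]} = (p₁^*Θ + n² p₂^*Θ − n m(Θ))^{[g]}`
  `= Σ_{i ≤ g} Σ_{k ≤ i} (n²)^{i−k} (−n)^k p₁^*Θ^{[g−i]} · p₂^*Θ^{[i−k]} · m(Θ)^{[k]}` for all `n ∈ ℤ` ((6.18), graph class as pull-back, theorem of the cube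
  g34-#5, divided-power binomial theorem).
* §2 `zsmul_kunnethProjector_eq_sum_nsDivPower`: `D · π_s = Σ_{k ≤ i ≤ g, 2i − k = s} (−1)^k p₁^*Θ^{[g−i]} · p₂^*Θ^{[i−k]} · m(Θ)^{[k]}` (`s ≤ 2g`,
  Vandermonde) — the Künneth projectors of ANY polarized complex torus are divided-power polynomials in divisor classes over `ℤ[1/D]`, an integral
  form of [Lange2023AbelianVarietiesComplex, Thm. 6.3.12]; `mumfordClass_cup_pullbackHom_sndHom_nsDivPower_eq_neg_zsmul`: the top coefficient,
  `m(Θ) · p₂^*Θ^{[g−1]} = −D · π_{2g−1}` (Künnemann's Thm. 2.3 with the degree kept).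
* §3 `integralHodgeClassesCorrComp_pontryaginCorrespondence_nsDivPower_pushforward_diagHom_sub_eq_zsmul_sum`: with g34-#4's Mumford form,
  `(s_X)_*π_{2g−1} = Σ_s (2g − s) π_s`, `[Θ] · Θ^{[g−1]} = g Θ^{[g]}` and `Π_{[pt]} = Σ_s π_s`:
  `Π_{Θ^{[g−1]}} ∘ Δ_*[Θ] − Δ_*[Θ] ∘ Π_{Θ^{[g−1]}} = D · Σ_{s=0}^{2g} (g − s) • π_s` — Künnemann's `[Λ, L] = Σ (g − i) π_i` [Kü2, Thm. 3.3] for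
  `L = Δ_*[Θ]`, `Λ = D^{-1} Π_{Θ^{[g−1]}}`, cleared of denominators, for every `Θ` (g34-#6 §4 is `D = 1`).
* §4 the corollaries for a Riemann form `θ` of type `t = (d₁, …, d_g)` (`Θ = −θ`, `D = ∏ tᵢ`, from g31's `θ^{[g]} = (−1)^g d₁⋯d_g [pt_X]`), and for every
  Riemann form with its canonical `polarizationType` (`…_of_isRiemannForm`): the relation holds for every polarized complex torus whatsoever.
* §5 the same relation written with g33-#5's grading correspondence `H_X = Σ_s (s − g) π_s`: `Δ_*[Θ] ∘ Π_{Θ^{[g−1]}} − Π_{Θ^{[g−1]}} ∘ Δ_*[Θ] = D · H_X`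
  (`[L, Λ] = H` cleared of `D`; `D = 1`, and type `(d₁, …, d_g)` versions) [Huybrechts2005, Prop. 1.2.26].

Theorems only; no new definitions, no named facts.

## References

* [Lange2023AbelianVarietiesComplex] H. Lange, *Abelian Varieties over the Complex Numbers*, Springer 2023 — §6.3.4 (6.18), Prop. 6.3.11, Thm. 6.3.12,
  Lemma 6.3.13 (p0318–p0320); §1.7.2 Thm. 1.7.3 (p0072), §2.5.3 Cor. 2.5.17, §3.6 Thm. 3.6.1, §1.5.1.
* [LangeBirkenhake1992] H. Lange, Ch. Birkenhake, *Complex Abelian Varieties*, Springer 1992 — §1.3 Exercise (12) (p0042 L10–L16), Ch. 2 Exercise (10)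
  (p0051 L8–L14).
* [Moonen2011ChowMotiveAbelianSchemes] B. Moonen, *On the Chow motive of an abelian scheme with non-trivial endomorphisms*, arXiv:1110.4264 — §5
  ([Kü2] Thm. 2.3, Thm. 3.3; p0015 L2–L5, p0017 L44 – p0018 L25).
* [Brown1982CohomologyGroups] K. S. Brown, *Cohomology of Groups*, Springer GTM 87, 1982 — Ch. V §6 (divided powers, p0131–p0132).
* [Huybrechts2005] D. Huybrechts, *Complex Geometry. An Introduction*, Springer 2005 — §1.2 Def. 1.2.25, Prop. 1.2.26 (PDF p0047).
-/

noncomputable section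

open CategoryTheory Function

namespace Literature.AlgebraicGeometry.HodgeTheory

open Literature.AlgebraicGeometry.Motives Literature.AlgebraicGeometry.Motives.HodgeStructure
open Literature.Geometry.Kaehler Literature.Geometry.Kaehler.ComplexTorus

namespace ComplexTorusCat

/-! ## §1 The generating identity with a degree: `D · Σ_s nˢ π_s = (p₁^*Θ + n² p₂^*Θ − n m(Θ))^{[g]}` for `Θ^{[g]} = D [pt_X]` -/

section Generating

variable (X : ComplexTorusCat) {gX gXX : ℕ} (eX : Fin (2 * gX) ≃ X.toIsog.ι) (eXX : Fin (2 * gXX) ≃ (prodObj X X).toIsog.ι)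
  (hX0 : 2 * gX + 2 * 0 = 2 * gX) (hgX : gX + gX = 2 * gX) (hcX : 2 * gX + 2 * gX = 2 * gXX) (hgXX : gXX + gXX = 2 * gXX)
  (Θ : neronSeveriGroup X.toIsog.Φ) (D : ℤ)

/-- **`D · Σ_{s=0}^{2g} nˢ π_s = (p₁^*Θ + n² p₂^*Θ − n m(Θ))^{[g]}`** for a divisor class `Θ ∈ NS(X)` with `Θ^{[g]} = D · [pt_X]` (`D = χ(L) = d₁⋯d_g` up to sign for a
polarization of type `(d₁, …, d_g)`) and every `n ∈ ℤ`: `Σ_s nˢ π_s = (pr₁ − n pr₂)^*[pt_X]` (g34-#6 §1), `f^*(Θ^{[g]}) = (f^*Θ)^{[g]}` and the theorem of the cube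
`(pr₁ − n pr₂)^*Θ = p₁^*Θ + n² p₂^*Θ − n m(Θ)` (g34-#5). [cite: Lange2023AbelianVarietiesComplex, §6.3.4 (6.18) (p0318 L10–L15)]
[cite: LangeBirkenhake1992, §1.3 Exercise (12) (p0042 L10–L16) and Ch. 2 Exercise (10) (p0051 L8–L14)] -/
theorem zsmul_sum_pow_smul_kunnethProjector_eq_nsDivPower (hΘ : nsDivPower X Θ gX = D • pointIntegralHodgeClass X eX) (n : ℤ) :
    D • ∑ s ∈ Finset.range (2 * gX + 1), (n ^ s) • kunnethProjector X eX eXX hX0 hgX hcX hgXX s =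
      nsDivPower (prodObj X X)
        (nsPullbackHom (fstHom X X) Θ + (n ^ 2) • nsPullbackHom (sndHom X X) Θ -
          n • (nsPullbackHom (addHom X) Θ - nsPullbackHom (fstHom X X) Θ - nsPullbackHom (sndHom X X) Θ)) gX := by
  rw [sum_pow_smul_kunnethProjector_eq_pullbackHom_pointIntegralHodgeClass, ← map_zsmul, ← hΘ, integralHodgeClassesPullbackHom_nsDivPower,
    nsPullbackHom_fstHom_sub_sndHom_intMul]

/-- **`D · Σ_{s=0}^{2g} nˢ π_s = Σ_{i ≤ g} p₁^*Θ^{[g−i]} · Σ_{k ≤ i} (n²)^{i−k} (−n)^k p₂^*Θ^{[i−k]} · m(Θ)^{[k]}`** for `Θ^{[g]} = D · [pt_X]`, `n ∈ ℤ` (the trinomial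
divided-power expansion, as in g34-#6 §1). [cite: Lange2023AbelianVarietiesComplex, §6.3.4 (6.18) (p0318 L10–L15)] [cite: Brown1982CohomologyGroups, Ch. V §6 (p0131 L4–L6)] -/
theorem zsmul_sum_pow_smul_kunnethProjector_eq_sum_sum (hΘ : nsDivPower X Θ gX = D • pointIntegralHodgeClass X eX) (n : ℤ) :
    D • ∑ s ∈ Finset.range (2 * gX + 1), (n ^ s) • kunnethProjector X eX eXX hX0 hgX hcX hgXX s =
      ∑ i : Fin (gX + 1), integralHodgeClassesCup (prodObj X X).toIsog.Φ (Nat.sub_add_cancel (Nat.lt_succ_iff.1 i.2))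
        (nsDivPower (prodObj X X) (nsPullbackHom (fstHom X X) Θ) (gX - i))
        (∑ k : Fin (i + 1), ((n ^ 2) ^ ((i : ℕ) - k) * (-n) ^ (k : ℕ)) •
          integralHodgeClassesCup (prodObj X X).toIsog.Φ (Nat.sub_add_cancel (Nat.lt_succ_iff.1 k.2))
            (nsDivPower (prodObj X X) (nsPullbackHom (sndHom X X) Θ) (i - k))
            (nsDivPower (prodObj X X) (nsPullbackHom (addHom X) Θ - nsPullbackHom (fstHom X X) Θ - nsPullbackHom (sndHom X X) Θ) k)) := by
  rw [zsmul_sum_pow_smul_kunnethProjector_eq_nsDivPower X eX eXX hX0 hgX hcX hgXX Θ D hΘ n, sub_eq_add_neg, ← neg_zsmul, add_assoc, nsDivPower_add]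
  refine Finset.sum_congr rfl fun i _ ↦ ?_
  rw [nsDivPower_add]
  congr 1
  refine Finset.sum_congr rfl fun k _ ↦ ?_
  rw [nsDivPower_zsmul, nsDivPower_zsmul, integralHodgeClassesCup_zsmul_left, integralHodgeClassesCup_zsmul_right, smul_smul]

end Generating

/-! ## §2 `D · π_s` as a divided-power polynomial, and `m(Θ) · p₂^*Θ^{[g−1]} = −D · π_{2g−1}` -/

section Formula

variable (X : ComplexTorusCat) {gX gXX : ℕ} (eX : Fin (2 * gX) ≃ X.toIsog.ι) (eXX : Fin (2 * gXX) ≃ (prodObj X X).toIsog.ι)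
  (hX0 : 2 * gX + 2 * 0 = 2 * gX) (hgX : gX + gX = 2 * gX) (hcX : 2 * gX + 2 * gX = 2 * gXX) (hgXX : gXX + gXX = 2 * gXX)
  (Θ : neronSeveriGroup X.toIsog.Φ) (D : ℤ)

/-- **`D · π_s = Σ_{k ≤ i ≤ g, 2i − k = s} (−1)^k p₁^*Θ^{[g−i]} · p₂^*Θ^{[i−k]} · m(Θ)^{[k]}`** in `Hdgᵍ(X × X, ℤ)` for every `s ≤ 2g` and every `Θ ∈ NS(X)` with
`Θ^{[g]} = D · [pt_X]` — the Künneth projectors of an arbitrarily polarized complex torus are divided-power polynomials in `p₁^*Θ, p₂^*Θ, μ^*Θ` over `ℤ[1/D]`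
(comparing coefficients of `nˢ`, `n ∈ ℕ`, in §1; g34-#6 §2 is `D = 1`). [cite: Lange2023AbelianVarietiesComplex, §6.3.4 (6.18), Prop. 6.3.11 and Thm. 6.3.12 (p0318 L10–L15,
p0319 L26, p0320 L1–L7)] [cite: Moonen2011ChowMotiveAbelianSchemes, §5 proof (p0018 L13–L14)] -/
theorem zsmul_kunnethProjector_eq_sum_nsDivPower (hΘ : nsDivPower X Θ gX = D • pointIntegralHodgeClass X eX) {s : ℕ} (hs : s ≤ 2 * gX) :
    D • kunnethProjector X eX eXX hX0 hgX hcX hgXX s =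
      ∑ x ∈ (Finset.univ : Finset (Σ i : Fin (gX + 1), Fin ((i : ℕ) + 1))).filter (fun x ↦ 2 * (x.1 : ℕ) - (x.2 : ℕ) = s),
        ((-1 : ℤ) ^ (x.2 : ℕ)) •
          integralHodgeClassesCup (prodObj X X).toIsog.Φ (Nat.sub_add_cancel (Nat.lt_succ_iff.1 x.1.2))
            (nsDivPower (prodObj X X) (nsPullbackHom (fstHom X X) Θ) (gX - x.1))
            (integralHodgeClassesCup (prodObj X X).toIsog.Φ (Nat.sub_add_cancel (Nat.lt_succ_iff.1 x.2.2))
              (nsDivPower (prodObj X X) (nsPullbackHom (sndHom X X) Θ) (x.1 - x.2))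
              (nsDivPower (prodObj X X) (nsPullbackHom (addHom X) Θ - nsPullbackHom (fstHom X X) Θ - nsPullbackHom (sndHom X X) Θ) x.2)) := by
  refine sub_eq_zero.1 (integralHodgeClasses_coeff_eq_zero_of_forall_nat
    (fun s ↦ D • kunnethProjector X eX eXX hX0 hgX hcX hgXX s -
      ∑ x ∈ (Finset.univ : Finset (Σ i : Fin (gX + 1), Fin ((i : ℕ) + 1))).filter (fun x ↦ 2 * (x.1 : ℕ) - (x.2 : ℕ) = s),
        ((-1 : ℤ) ^ (x.2 : ℕ)) •
          integralHodgeClassesCup (prodObj X X).toIsog.Φ (Nat.sub_add_cancel (Nat.lt_succ_iff.1 x.1.2))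
            (nsDivPower (prodObj X X) (nsPullbackHom (fstHom X X) Θ) (gX - x.1))
            (integralHodgeClassesCup (prodObj X X).toIsog.Φ (Nat.sub_add_cancel (Nat.lt_succ_iff.1 x.2.2))
              (nsDivPower (prodObj X X) (nsPullbackHom (sndHom X X) Θ) (x.1 - x.2))
              (nsDivPower (prodObj X X) (nsPullbackHom (addHom X) Θ - nsPullbackHom (fstHom X X) Θ - nsPullbackHom (sndHom X X) Θ) x.2)))
    (fun n ↦ ?_) hs)
  simp only [smul_sub, Finset.sum_sub_distrib, sub_eq_zero]
  rw [Finset.sum_congr rfl fun s _ ↦ smul_comm ((n : ℤ) ^ s) D (kunnethProjector X eX eXX hX0 hgX hcX hgXX s), ← Finset.smul_sum,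
    zsmul_sum_pow_smul_kunnethProjector_eq_sum_sum X eX eXX hX0 hgX hcX hgXX Θ D hΘ (n : ℤ)]
  simp_rw [map_sum, integralHodgeClassesCup_zsmul_right, Finset.smul_sum]
  rw [Finset.sum_sigma' Finset.univ (fun i : Fin (gX + 1) ↦ (Finset.univ : Finset (Fin ((i : ℕ) + 1)))), Finset.univ_sigma_univ,
    ← Finset.sum_fiberwise_of_maps_to (s := Finset.univ) (t := Finset.range (2 * gX + 1))
      (g := fun x : (Σ i : Fin (gX + 1), Fin ((i : ℕ) + 1)) ↦ 2 * (x.1 : ℕ) - (x.2 : ℕ)) (fun x _ ↦ Finset.mem_range.2 (by have := x.1.2; omega))]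
  refine Finset.sum_congr rfl fun s _ ↦ Finset.sum_congr rfl fun x hx ↦ ?_
  have hk : (x.2 : ℕ) ≤ x.1 := Nat.lt_succ_iff.1 x.2.2
  rw [← (Finset.mem_filter.1 hx).2, smul_smul]
  congr 1
  rw [show 2 * (x.1 : ℕ) - x.2 = 2 * ((x.1 : ℕ) - x.2) + x.2 by omega, pow_add, pow_mul, neg_pow]
  ring

/-- `α^{[i]} · y = y` when `i = 0`, for an index written as `i`. [cite: Brown1982CohomologyGroups, Ch. V §6 (p0131 L4)] -/
private theorem cup_nsDivPower_of_eq_zero₇ {Y : ComplexTorusCat} (α : neronSeveriGroup Y.toIsog.Φ) {i r : ℕ} (h : i + r = r)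
    (y : integralHodgeClasses Y.toIsog.Φ r) (hi : i = 0) : integralHodgeClassesCup Y.toIsog.Φ h (nsDivPower Y α i) y = y := by
  subst hi
  rw [nsDivPower_zero_eq_unitIntegralHodgeClass, integralHodgeClassesCup_unitIntegralHodgeClass_left]

/-- `β^{[j]} · y = y · β^{[d]}` when `j = d`, for an index written as `j`. [cite: Brown1982CohomologyGroups, Ch. V §6 (p0131 L4)] -/
private theorem cup_nsDivPower_of_eq₇ {Y : ComplexTorusCat} (β : neronSeveriGroup Y.toIsog.Φ) {j d r : ℕ} (h : j + 1 = r) (hcd : 1 + d = r)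
    (y : integralHodgeClasses Y.toIsog.Φ 1) (hj : j = d) :
    integralHodgeClassesCup Y.toIsog.Φ h (nsDivPower Y β j) y = integralHodgeClassesCup Y.toIsog.Φ hcd y (nsDivPower Y β d) := by
  subst hj
  rw [integralHodgeClassesCup_comm _ hcd h]

/-- A sum over a filter of `univ` singling out one element. [folklore] -/
private theorem sum_filter_eq_single₇ {ι M : Type*} [Fintype ι] [AddCommMonoid M] (p : ι → Prop) [DecidablePred p] (f : ι → M) (a : ι) (ha : p a)
    (huniq : ∀ b, p b → b = a) : ∑ x ∈ Finset.univ.filter p, f x = f a :=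
  Finset.sum_eq_single_of_mem a (Finset.mem_filter.2 ⟨Finset.mem_univ _, ha⟩) fun b hb hne ↦ absurd (huniq b (Finset.mem_filter.1 hb).2) hne

/-- **`m(Θ) · p₂^*Θ^{[g−1]} = −D · π_{2g−1}`** for every complex torus `X` of dimension `g = d + 1` and every `Θ ∈ NS(X)` with `Θ^{[g]} = D · [pt_X]` — Künnemann's
Theorem 2.3 with the degree `D` of the polarization kept (the coefficient of `n^{2g−1}` in §1 is the single pair `(i, k) = (g, 1)`; g34-#6 §3 is `D = 1`).
[cite: Moonen2011ChowMotiveAbelianSchemes, §5 proof (p0018 L13–L20)] [cite: Lange2023AbelianVarietiesComplex, §6.3.4 Thm. 6.3.12 (p0320 L1–L7)] -/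
theorem mumfordClass_cup_pullbackHom_sndHom_nsDivPower_eq_neg_zsmul (hΘ : nsDivPower X Θ gX = D • pointIntegralHodgeClass X eX) {d : ℕ} (hd : d + 1 = gX)
    (hcd : 1 + d = gX) :
    integralHodgeClassesCup (prodObj X X).toIsog.Φ hcd
        (integralHodgeClassesPullbackHom (addHom X) 1 (neronSeveriGroupEquiv X.toIsog.Φ Θ)
          - integralHodgeClassesPullbackHom (fstHom X X) 1 (neronSeveriGroupEquiv X.toIsog.Φ Θ)
          - integralHodgeClassesPullbackHom (sndHom X X) 1 (neronSeveriGroupEquiv X.toIsog.Φ Θ))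
        (integralHodgeClassesPullbackHom (sndHom X X) d (nsDivPower X Θ d)) =
      -(D • kunnethProjector X eX eXX hX0 hgX hcX hgXX (2 * gX - 1)) := by
  subst hd
  rw [zsmul_kunnethProjector_eq_sum_nsDivPower X eX eXX hX0 hgX hcX hgXX Θ D hΘ (s := 2 * (d + 1) - 1) (by omega),
    sum_filter_eq_single₇ (fun x : (Σ i : Fin (d + 1 + 1), Fin ((i : ℕ) + 1)) ↦ 2 * (x.1 : ℕ) - (x.2 : ℕ) = 2 * (d + 1) - 1) _
      ⟨⟨d + 1, by omega⟩, ⟨1, Nat.succ_lt_succ (Nat.succ_pos d)⟩⟩ rfl (by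
        rintro ⟨⟨i, hi⟩, ⟨k, hk⟩⟩ h2
        dsimp only at h2 hk
        obtain rfl : i = d + 1 := by omega
        obtain rfl : k = 1 := by omega
        rfl)]
  simp only [Fin.val_mk]
  rw [cup_nsDivPower_of_eq_zero₇ (nsPullbackHom (fstHom X X) Θ) _ _ (Nat.sub_self _), nsDivPower_one,
    cup_nsDivPower_of_eq₇ (nsPullbackHom (sndHom X X) Θ) _ hcd _ (Nat.add_sub_cancel d 1), pow_one, neg_one_zsmul, neg_neg,
    ← integralHodgeClassesPullbackHom_nsDivPower, map_sub (neronSeveriGroupEquiv (prodObj X X).toIsog.Φ),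
    map_sub (neronSeveriGroupEquiv (prodObj X X).toIsog.Φ), neronSeveriGroupEquiv_nsPullbackHom, neronSeveriGroupEquiv_nsPullbackHom,
    neronSeveriGroupEquiv_nsPullbackHom]

end Formula

/-! ## §3 `[Π_{Θ^{[g−1]}}, Δ_*[Θ]] = D · Σ_s (g − s) π_s` for every `Θ` with `Θ^{[g]} = D [pt_X]` -/

section Kunnemann

variable (X : ComplexTorusCat) {gX gXX gT : ℕ} (eX : Fin (2 * gX) ≃ X.toIsog.ι) (eXX : Fin (2 * gXX) ≃ (prodObj X X).toIsog.ι)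
  (eT : Fin (2 * gT) ≃ (prodObj X (prodObj X X)).toIsog.ι) (hX0 : 2 * gX + 2 * 0 = 2 * gX) (hgX : gX + gX = 2 * gX) (hcX : 2 * gX + 2 * gX = 2 * gXX)
  (hgXX : gXX + gXX = 2 * gXX) (hgT : gT + gT = 2 * gT) (hN : 2 * gX + 2 * gXX = 2 * gT) (hgg₀ : gX + gXX = gT) (hXX0 : 2 * gXX + 2 * 0 = 2 * gXX)
  (hlr₀ : 2 * gXX + 2 * gX = 2 * gT) (hXXg : gX + gX = gXX) {C : ℕ} (hCC : gX + gX = C) (hC : 2 * gX + 2 * C = 2 * gT)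
  {c₁ d K₁ K₂ l l₃ l₃' L Lm : ℕ} (hl : l + 2 * 1 = 2 * gX) (hl' : l + 2 * c₁ = 2 * gXX) (hq : L + 2 * d = 2 * gXX) (hK₁ : c₁ + d = K₁)
  (h3₁ : l₃ + 2 * K₁ = 2 * gT) (h3₁' : l₃ + 2 * gX = 2 * gXX) (hcd : 1 + d = gX) (hdc : d + 1 = gX) (hK₂ : d + c₁ = K₂) (h3₂ : l₃' + 2 * K₂ = 2 * gT)
  (h3₂' : l₃' + 2 * gX = 2 * gXX) (hqm : Lm + 2 * gX = 2 * gXX) (Θ : neronSeveriGroup X.toIsog.Φ) (D : ℤ)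

include hX0 hN hgg₀ hXX0 hlr₀ hXXg hCC hC hcd hdc hqm in
/-- **`Π_{Θ^{[g−1]}} ∘ Δ_*[Θ] − Δ_*[Θ] ∘ Π_{Θ^{[g−1]}} = D · Σ_{s=0}^{2g} (g − s) • π_s` FOR EVERY DIVISOR CLASS `Θ` WITH `Θ^{[g]} = D · [pt_X]`** on a complex torus `X` of
dimension `g = d + 1` — Künnemann's `[Λ, L] = Σ (g − i) π_i` [Kü2, Thm. 3.3] for an ARBITRARY polarization, with `Λ = D^{-1} Π_{Θ^{[g−1]}}` cleared of its
denominator (`D = d₁⋯d_g` for type `(d₁, …, d_g)`, §4): g34-#4's Mumford form `= −(s_X)_*(m(Θ) · p₂^*Θ^{[g−1]}) − Π_{[Θ]·Θ^{[g−1]}}`, §2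
`m(Θ) · p₂^*Θ^{[g−1]} = −D π_{2g−1}`, `(s_X)_*π_{2g−1} = Σ_s (2g − s) π_s`, `[Θ] · Θ^{[g−1]} = g Θ^{[g]} = gD [pt_X]` and `Π_{[pt]} = [Δ] = Σ_s π_s`. (g34-#6 §4 is `D = 1`.)
[cite: Moonen2011ChowMotiveAbelianSchemes, §5 (p0015 L2–L5) and §5 proof (p0017 L44 – p0018 L25)] [cite: Lange2023AbelianVarietiesComplex, §6.3.4 Thm. 6.3.12 and Lemma 6.3.13
(p0320 L1–L17)] [cite: Brown1982CohomologyGroups, Ch. V §6 (p0131 L5)] -/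
theorem integralHodgeClassesCorrComp_pontryaginCorrespondence_nsDivPower_pushforward_diagHom_sub_eq_zsmul_sum
    (hΘ : nsDivPower X Θ gX = D • pointIntegralHodgeClass X eX) :
    integralHodgeClassesPushforward K₁ gX (liftHom (fstHom X (prodObj X X)) (sndHom X (prodObj X X) ≫ sndHom X X)) eT eXX h3₁ hgT h3₁' hgXX
      (integralHodgeClassesCup (prodObj X (prodObj X X)).toIsog.Φ hK₁
        (integralHodgeClassesPullbackHom (liftHom (fstHom X (prodObj X X)) (sndHom X (prodObj X X) ≫ fstHom X X)) c₁
          (integralHodgeClassesPushforward 1 c₁ (diagHom X) eX eXX hl hgX hl' hgXX (neronSeveriGroupEquiv X.toIsog.Φ Θ)))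
        (integralHodgeClassesPullbackHom (sndHom X (prodObj X X)) d
          (integralHodgeClassesPushforward d d (liftHom (fstHom X X) (fstHom X X + sndHom X X)) eXX eXX hq hgXX hq hgXX
            (integralHodgeClassesPullbackHom (sndHom X X) d (nsDivPower X Θ d))))) -
      integralHodgeClassesPushforward K₂ gX (liftHom (fstHom X (prodObj X X)) (sndHom X (prodObj X X) ≫ sndHom X X)) eT eXX h3₂ hgT h3₂' hgXX
        (integralHodgeClassesCup (prodObj X (prodObj X X)).toIsog.Φ hK₂
          (integralHodgeClassesPullbackHom (liftHom (fstHom X (prodObj X X)) (sndHom X (prodObj X X) ≫ fstHom X X)) d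
            (integralHodgeClassesPushforward d d (liftHom (fstHom X X) (fstHom X X + sndHom X X)) eXX eXX hq hgXX hq hgXX
              (integralHodgeClassesPullbackHom (sndHom X X) d (nsDivPower X Θ d))))
          (integralHodgeClassesPullbackHom (sndHom X (prodObj X X)) c₁
            (integralHodgeClassesPushforward 1 c₁ (diagHom X) eX eXX hl hgX hl' hgXX (neronSeveriGroupEquiv X.toIsog.Φ Θ)))) =
      ∑ s ∈ Finset.range (2 * gX + 1), (D * ((gX : ℤ) - s)) • kunnethProjector X eX eXX hX0 hgX hcX hgXX s := by
  have hθγ : integralHodgeClassesCup X.toIsog.Φ hcd (neronSeveriGroupEquiv X.toIsog.Φ Θ) (nsDivPower X Θ d) = ((gX : ℤ) * D) • pointIntegralHodgeClass X eX := by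
    rw [integralHodgeClassesCup_comm X.toIsog.Φ hdc hcd, ← nsDivPower_one]
    subst hdc
    rw [integralHodgeClassesCup_nsDivPower, hΘ, smul_smul, Nat.choose_succ_self_right]
  have hX : 0 < gX := by omega
  obtain rfl : Lm = 2 * gX := by omega
  rw [integralHodgeClassesCorrComp_pushforward_diagHom_pontryaginCorrespondence_sub_eq_mumfordForm X eX eXX eT hgX hcX hgXX hgT hN hlr₀ hl hl' hq hK₁ h3₁ h3₁' hcd hdc
      hK₂ h3₂ h3₂' hqm (neronSeveriGroupEquiv X.toIsog.Φ Θ) (nsDivPower X Θ d),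
    mumfordClass_cup_pullbackHom_sndHom_nsDivPower_eq_neg_zsmul X eX eXX hX0 hgX hcX hgXX Θ D hΘ hdc hcd, hθγ, map_neg, neg_neg, map_zsmul,
    integralHodgeClassesPushforward_shear_kunnethProjector_sub_one X eX eXX eT hX0 hgX hcX hgXX hgT hgg₀ hXX0 hlr₀ hCC hC hX,
    map_zsmul, map_zsmul, pontryaginCorrespondence_pointIntegralHodgeClass X eX eXX hX0 hgX hcX hgXX hXXg hqm,
    ← sum_range_kunnethProjector X eX eXX hX0 hgX hcX hgXX, Finset.smul_sum, Finset.smul_sum, ← Finset.sum_sub_distrib]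
  refine Finset.sum_congr rfl fun s _ ↦ ?_
  rw [smul_smul, ← sub_smul]
  congr 1
  ring

end Kunnemann

/-! ## §4 Polarizations of type `(d₁, …, d_g)`: `Θ = −θ = c₁(L)`, `D = d₁⋯d_g` -/

section PolarizationType

variable (X : ComplexTorusCat) {gX gXX gT : ℕ} (eX : Fin (2 * gX) ≃ X.toIsog.ι) (eXX : Fin (2 * gXX) ≃ (prodObj X X).toIsog.ι)
  (eT : Fin (2 * gT) ≃ (prodObj X (prodObj X X)).toIsog.ι) (hX0 : 2 * gX + 2 * 0 = 2 * gX) (hgX : gX + gX = 2 * gX) (hcX : 2 * gX + 2 * gX = 2 * gXX)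
  (hgXX : gXX + gXX = 2 * gXX) (hgT : gT + gT = 2 * gT) (hN : 2 * gX + 2 * gXX = 2 * gT) (hgg₀ : gX + gXX = gT) (hXX0 : 2 * gXX + 2 * 0 = 2 * gXX)
  (hlr₀ : 2 * gXX + 2 * gX = 2 * gT) (hXXg : gX + gX = gXX) {C : ℕ} (hCC : gX + gX = C) (hC : 2 * gX + 2 * C = 2 * gT)
  {c₁ d K₁ K₂ l l₃ l₃' L Lm : ℕ} (hl : l + 2 * 1 = 2 * gX) (hl' : l + 2 * c₁ = 2 * gXX) (hq : L + 2 * d = 2 * gXX) (hK₁ : c₁ + d = K₁)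
  (h3₁ : l₃ + 2 * K₁ = 2 * gT) (h3₁' : l₃ + 2 * gX = 2 * gXX) (hcd : 1 + d = gX) (hdc : d + 1 = gX) (hK₂ : d + c₁ = K₂) (h3₂ : l₃' + 2 * K₂ = 2 * gT)
  (h3₂' : l₃' + 2 * gX = 2 * gXX) (hqm : Lm + 2 * gX = 2 * gXX) {θ : neronSeveriGroup X.toIsog.Φ} {t : Fin gX → ℕ}
  (hθ : IsRiemannForm X.toIsog.Φ (θ : X.toIsog.E [⋀^Fin 2]→L[ℝ] ℝ)) (ht : IsPolarizationType X.toIsog.Φ (θ : X.toIsog.E [⋀^Fin 2]→L[ℝ] ℝ) t)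

include hθ ht in
/-- **`(−θ)^{[g]} = (d₁⋯d_g) · [pt_X]` for a polarization `θ` of type `(d₁, …, d_g)`** (g31's Riemann–Roch `θ^{[g]} = (−1)^g d₁⋯d_g [pt_X]`, the sign because the tree's
Riemann form is `−c₁(L)`, and `(−θ)^{[g]} = (−1)^g θ^{[g]}`): `Θ = −θ = c₁(L)` satisfies `Θ^{[g]} = D [pt_X]` with `D = d₁⋯d_g = χ(L)`.
[cite: Lange2023AbelianVarietiesComplex, §1.7.2 Thm. 1.7.3 (p0072 L21–L23), §2.5.3 Cor. 2.5.17 (a) (p0135) and §3.6 Thm. 3.6.1] [cite: Brown1982CohomologyGroups, Ch. V §6 (p0131 L6)] -/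
theorem nsDivPower_neg_top_eq_zsmul_pointIntegralHodgeClass_of_isPolarizationType :
    nsDivPower X (-θ) gX = (∏ i, (t i : ℤ)) • pointIntegralHodgeClass X eX := by
  rw [nsDivPower_neg, nsDivPower_top_eq_zsmul_pointIntegralHodgeClass X eX hθ ht, smul_smul, ← mul_assoc, ← mul_pow, neg_mul_neg, one_mul, one_pow,
    one_mul]

include hdc hθ ht in
/-- **Künnemann's Theorem 2.3 for a polarized complex torus of type `(d₁, …, d_g)`: `m(Θ) · p₂^*Θ^{[g−1]} = −(d₁⋯d_g) · π_{2g−1}`, `Θ = −θ = c₁(L)`.**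
[cite: Moonen2011ChowMotiveAbelianSchemes, §5 proof (p0018 L13–L20)] [cite: Lange2023AbelianVarietiesComplex, §6.3.4 Thm. 6.3.12 (p0320 L1–L7) and §1.7.2 Thm. 1.7.3 (p0072 L21–L23)] -/
theorem mumfordClass_cup_pullbackHom_sndHom_nsDivPower_of_isPolarizationType :
    integralHodgeClassesCup (prodObj X X).toIsog.Φ hcd
        (integralHodgeClassesPullbackHom (addHom X) 1 (neronSeveriGroupEquiv X.toIsog.Φ (-θ))
          - integralHodgeClassesPullbackHom (fstHom X X) 1 (neronSeveriGroupEquiv X.toIsog.Φ (-θ))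
          - integralHodgeClassesPullbackHom (sndHom X X) 1 (neronSeveriGroupEquiv X.toIsog.Φ (-θ)))
        (integralHodgeClassesPullbackHom (sndHom X X) d (nsDivPower X (-θ) d)) =
      -((∏ i, (t i : ℤ)) • kunnethProjector X eX eXX hX0 hgX hcX hgXX (2 * gX - 1)) :=
  mumfordClass_cup_pullbackHom_sndHom_nsDivPower_eq_neg_zsmul X eX eXX hX0 hgX hcX hgXX (-θ) _
    (nsDivPower_neg_top_eq_zsmul_pointIntegralHodgeClass_of_isPolarizationType X eX hθ ht) hdc hcd

include hN hgg₀ hXX0 hlr₀ hXXg hCC hC hcd hdc hqm hθ ht in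
/-- **KÜNNEMANN'S RELATION FOR EVERY POLARIZED COMPLEX TORUS `(X, θ)` OF TYPE `(d₁, …, d_g)` — in particular for every polarized abelian variety:
`Π_{Θ^{[g−1]}} ∘ Δ_*[Θ] − Δ_*[Θ] ∘ Π_{Θ^{[g−1]}} = (d₁⋯d_g) · Σ_{s=0}^{2g} (g − s) • π_s`**, `Θ = −θ = c₁(L)` (§3 with `D = d₁⋯d_g`): the 𝔰𝔩₂-relation
`[Λ, L] = Σ (g − i) π_i` for `L = Δ_*[Θ]` and `Λ = (d₁⋯d_g)^{-1} Π_{Θ^{[g−1]}}`, cleared of denominators, on `Hdg•(X × X, ℤ)`.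
[cite: Moonen2011ChowMotiveAbelianSchemes, §5 (p0015 L2–L5) and §5 proof (p0017 L44 – p0018 L25)] [cite: Lange2023AbelianVarietiesComplex, §6.3.4 Thm. 6.3.12 (p0320 L1–L7) and
§1.7.2 Thm. 1.7.3 (p0072 L21–L23)] -/
theorem integralHodgeClassesCorrComp_pontryaginCorrespondence_nsDivPower_pushforward_diagHom_sub_eq_zsmul_sum_of_isPolarizationType :
    integralHodgeClassesPushforward K₁ gX (liftHom (fstHom X (prodObj X X)) (sndHom X (prodObj X X) ≫ sndHom X X)) eT eXX h3₁ hgT h3₁' hgXX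
      (integralHodgeClassesCup (prodObj X (prodObj X X)).toIsog.Φ hK₁
        (integralHodgeClassesPullbackHom (liftHom (fstHom X (prodObj X X)) (sndHom X (prodObj X X) ≫ fstHom X X)) c₁
          (integralHodgeClassesPushforward 1 c₁ (diagHom X) eX eXX hl hgX hl' hgXX (neronSeveriGroupEquiv X.toIsog.Φ (-θ))))
        (integralHodgeClassesPullbackHom (sndHom X (prodObj X X)) d
          (integralHodgeClassesPushforward d d (liftHom (fstHom X X) (fstHom X X + sndHom X X)) eXX eXX hq hgXX hq hgXX
            (integralHodgeClassesPullbackHom (sndHom X X) d (nsDivPower X (-θ) d))))) -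
      integralHodgeClassesPushforward K₂ gX (liftHom (fstHom X (prodObj X X)) (sndHom X (prodObj X X) ≫ sndHom X X)) eT eXX h3₂ hgT h3₂' hgXX
        (integralHodgeClassesCup (prodObj X (prodObj X X)).toIsog.Φ hK₂
          (integralHodgeClassesPullbackHom (liftHom (fstHom X (prodObj X X)) (sndHom X (prodObj X X) ≫ fstHom X X)) d
            (integralHodgeClassesPushforward d d (liftHom (fstHom X X) (fstHom X X + sndHom X X)) eXX eXX hq hgXX hq hgXX
              (integralHodgeClassesPullbackHom (sndHom X X) d (nsDivPower X (-θ) d))))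
          (integralHodgeClassesPullbackHom (sndHom X (prodObj X X)) c₁
            (integralHodgeClassesPushforward 1 c₁ (diagHom X) eX eXX hl hgX hl' hgXX (neronSeveriGroupEquiv X.toIsog.Φ (-θ))))) =
      ∑ s ∈ Finset.range (2 * gX + 1), ((∏ i, (t i : ℤ)) * ((gX : ℤ) - s)) • kunnethProjector X eX eXX hX0 hgX hcX hgXX s :=
  integralHodgeClassesCorrComp_pontryaginCorrespondence_nsDivPower_pushforward_diagHom_sub_eq_zsmul_sum X eX eXX eT hX0 hgX hcX hgXX hgT hN hgg₀ hXX0 hlr₀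
    hXXg hCC hC hl hl' hq hK₁ h3₁ h3₁' hcd hdc hK₂ h3₂ h3₂' hqm (-θ) _ (nsDivPower_neg_top_eq_zsmul_pointIntegralHodgeClass_of_isPolarizationType X eX hθ ht)

omit ht in
include hN hgg₀ hXX0 hlr₀ hXXg hCC hC hcd hdc hqm hθ in
/-- **The same for EVERY Riemann form `θ` on `X`, with its canonical type `(d₁, …, d_g) = polarizationType θ`** (a type always exists, p24
`IsRiemannForm.isPolarizationType_polarizationType`; `g = (rk H₁)/2` read off the frame `eX`): Künnemann's relation, cleared of the denominator `d₁⋯d_g`, holds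
on the integral Hodge classes of `X × X` for every polarized complex torus whatsoever. [cite: Moonen2011ChowMotiveAbelianSchemes, §5 (p0015 L2–L5)]
[cite: Lange2023AbelianVarietiesComplex, §1.5.1 (p0051), §3.6 Thm. 3.6.1 and §6.3.4 Thm. 6.3.12 (p0320 L1–L7)] -/
theorem integralHodgeClassesCorrComp_pontryaginCorrespondence_nsDivPower_pushforward_diagHom_sub_eq_zsmul_sum_of_isRiemannForm
    (hg : gX = Fintype.card X.toIsog.ι / 2) :
    integralHodgeClassesPushforward K₁ gX (liftHom (fstHom X (prodObj X X)) (sndHom X (prodObj X X) ≫ sndHom X X)) eT eXX h3₁ hgT h3₁' hgXX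
      (integralHodgeClassesCup (prodObj X (prodObj X X)).toIsog.Φ hK₁
        (integralHodgeClassesPullbackHom (liftHom (fstHom X (prodObj X X)) (sndHom X (prodObj X X) ≫ fstHom X X)) c₁
          (integralHodgeClassesPushforward 1 c₁ (diagHom X) eX eXX hl hgX hl' hgXX (neronSeveriGroupEquiv X.toIsog.Φ (-θ))))
        (integralHodgeClassesPullbackHom (sndHom X (prodObj X X)) d
          (integralHodgeClassesPushforward d d (liftHom (fstHom X X) (fstHom X X + sndHom X X)) eXX eXX hq hgXX hq hgXX
            (integralHodgeClassesPullbackHom (sndHom X X) d (nsDivPower X (-θ) d))))) -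
      integralHodgeClassesPushforward K₂ gX (liftHom (fstHom X (prodObj X X)) (sndHom X (prodObj X X) ≫ sndHom X X)) eT eXX h3₂ hgT h3₂' hgXX
        (integralHodgeClassesCup (prodObj X (prodObj X X)).toIsog.Φ hK₂
          (integralHodgeClassesPullbackHom (liftHom (fstHom X (prodObj X X)) (sndHom X (prodObj X X) ≫ fstHom X X)) d
            (integralHodgeClassesPushforward d d (liftHom (fstHom X X) (fstHom X X + sndHom X X)) eXX eXX hq hgXX hq hgXX
              (integralHodgeClassesPullbackHom (sndHom X X) d (nsDivPower X (-θ) d))))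
          (integralHodgeClassesPullbackHom (sndHom X (prodObj X X)) c₁
            (integralHodgeClassesPushforward 1 c₁ (diagHom X) eX eXX hl hgX hl' hgXX (neronSeveriGroupEquiv X.toIsog.Φ (-θ))))) =
      ∑ s ∈ Finset.range (2 * gX + 1), ((∏ i : Fin gX, (hθ.polarizationType (Fin.cast hg i) : ℤ)) * ((gX : ℤ) - s)) •
        kunnethProjector X eX eXX hX0 hgX hcX hgXX s :=
  integralHodgeClassesCorrComp_pontryaginCorrespondence_nsDivPower_pushforward_diagHom_sub_eq_zsmul_sum_of_isPolarizationType X eX eXX eT hX0 hgX hcX hgXX hgT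
    hN hgg₀ hXX0 hlr₀ hXXg hCC hC hl hl' hq hK₁ h3₁ h3₁' hcd hdc hK₂ h3₂ h3₂' hqm hθ (hθ.isPolarizationType_polarizationType.comp_cast hg)

end PolarizationType

/-! ## §5 In terms of the grading correspondence `H_X = Σ_s (s − g) π_s` (g33-#5): `[Δ_*[Θ], Π_{Θ^{[g−1]}}] = D · H_X` -/

section Grading

variable (X : ComplexTorusCat) {gX gXX gT : ℕ} (eX : Fin (2 * gX) ≃ X.toIsog.ι) (eXX : Fin (2 * gXX) ≃ (prodObj X X).toIsog.ι)
  (eT : Fin (2 * gT) ≃ (prodObj X (prodObj X X)).toIsog.ι) (hX0 : 2 * gX + 2 * 0 = 2 * gX) (hgX : gX + gX = 2 * gX) (hcX : 2 * gX + 2 * gX = 2 * gXX)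
  (hgXX : gXX + gXX = 2 * gXX) (hgT : gT + gT = 2 * gT) (hN : 2 * gX + 2 * gXX = 2 * gT) (hgg₀ : gX + gXX = gT) (hXX0 : 2 * gXX + 2 * 0 = 2 * gXX)
  (hlr₀ : 2 * gXX + 2 * gX = 2 * gT) (hXXg : gX + gX = gXX) {C : ℕ} (hCC : gX + gX = C) (hC : 2 * gX + 2 * C = 2 * gT)
  {c₁ d K₁ K₂ l l₃ l₃' L Lm : ℕ} (hl : l + 2 * 1 = 2 * gX) (hl' : l + 2 * c₁ = 2 * gXX) (hq : L + 2 * d = 2 * gXX) (hK₁ : c₁ + d = K₁)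
  (h3₁ : l₃ + 2 * K₁ = 2 * gT) (h3₁' : l₃ + 2 * gX = 2 * gXX) (hcd : 1 + d = gX) (hdc : d + 1 = gX) (hK₂ : d + c₁ = K₂) (h3₂ : l₃' + 2 * K₂ = 2 * gT)
  (h3₂' : l₃' + 2 * gX = 2 * gXX) (hqm : Lm + 2 * gX = 2 * gXX) (Θ : neronSeveriGroup X.toIsog.Φ) (D : ℤ)

include hX0 hN hgg₀ hXX0 hlr₀ hXXg hCC hC hcd hdc hqm in
/-- **`Δ_*[Θ] ∘ Π_{Θ^{[g−1]}} − Π_{Θ^{[g−1]}} ∘ Δ_*[Θ] = D · H_X`: THE RELATION `[L, Λ] = H` OF THE LEFSCHETZ 𝔰𝔩₂-TRIPLE `(L, Λ, H) = (Δ_*[Θ], D^{-1} Π_{Θ^{[g−1]}}, H_X)`,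
cleared of the denominator `D`,** for every complex torus `X` of dimension `g = d + 1` and every `Θ ∈ NS(X)` with `Θ^{[g]} = D [pt_X]`: §3 and g33-#5's
`H_X = Σ_s (s − g) • π_s` (Huybrechts' counting operator `H = Σ_k (k − n) Πᵏ`, `[L, Λ] = H`). Together with g33-#5 `[H_X, Δ_*(u)] = 2c • Δ_*(u)` (`[H, L] = 2L` at
`c = 1`) and g34-#1 `[H_X, Π_c] = (2d − 2g) • Π_c` (`[H, Λ] = −2Λ` at `d = g − 1`) these are the three 𝔰𝔩₂-relations of Künnemann's Lefschetz triple on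
`Hdg•(X × X, ℤ)`. [cite: Huybrechts2005, §1.2 Def. 1.2.25 and Prop. 1.2.26 (p0047 L7–L19)] [cite: Moonen2011ChowMotiveAbelianSchemes, §5 (p0015 L2–L5) and §5 proof
(p0017 L44 – p0018 L25)] -/
theorem integralHodgeClassesCorrComp_pushforward_diagHom_pontryaginCorrespondence_nsDivPower_sub_eq_zsmul_kunnethGrading
    (hΘ : nsDivPower X Θ gX = D • pointIntegralHodgeClass X eX) :
    integralHodgeClassesPushforward K₂ gX (liftHom (fstHom X (prodObj X X)) (sndHom X (prodObj X X) ≫ sndHom X X)) eT eXX h3₂ hgT h3₂' hgXX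
      (integralHodgeClassesCup (prodObj X (prodObj X X)).toIsog.Φ hK₂
        (integralHodgeClassesPullbackHom (liftHom (fstHom X (prodObj X X)) (sndHom X (prodObj X X) ≫ fstHom X X)) d
          (integralHodgeClassesPushforward d d (liftHom (fstHom X X) (fstHom X X + sndHom X X)) eXX eXX hq hgXX hq hgXX
            (integralHodgeClassesPullbackHom (sndHom X X) d (nsDivPower X Θ d))))
        (integralHodgeClassesPullbackHom (sndHom X (prodObj X X)) c₁
          (integralHodgeClassesPushforward 1 c₁ (diagHom X) eX eXX hl hgX hl' hgXX (neronSeveriGroupEquiv X.toIsog.Φ Θ)))) -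
      integralHodgeClassesPushforward K₁ gX (liftHom (fstHom X (prodObj X X)) (sndHom X (prodObj X X) ≫ sndHom X X)) eT eXX h3₁ hgT h3₁' hgXX
        (integralHodgeClassesCup (prodObj X (prodObj X X)).toIsog.Φ hK₁
          (integralHodgeClassesPullbackHom (liftHom (fstHom X (prodObj X X)) (sndHom X (prodObj X X) ≫ fstHom X X)) c₁
            (integralHodgeClassesPushforward 1 c₁ (diagHom X) eX eXX hl hgX hl' hgXX (neronSeveriGroupEquiv X.toIsog.Φ Θ)))
          (integralHodgeClassesPullbackHom (sndHom X (prodObj X X)) d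
            (integralHodgeClassesPushforward d d (liftHom (fstHom X X) (fstHom X X + sndHom X X)) eXX eXX hq hgXX hq hgXX
              (integralHodgeClassesPullbackHom (sndHom X X) d (nsDivPower X Θ d))))) =
      D • kunnethGrading X eX eXX hX0 hgX hcX hgXX := by
  rw [← neg_sub, integralHodgeClassesCorrComp_pontryaginCorrespondence_nsDivPower_pushforward_diagHom_sub_eq_zsmul_sum X eX eXX eT hX0 hgX hcX hgXX hgT hN hgg₀
      hXX0 hlr₀ hXXg hCC hC hl hl' hq hK₁ h3₁ h3₁' hcd hdc hK₂ h3₂ h3₂' hqm Θ D hΘ, kunnethGrading_def, Finset.smul_sum, ← Finset.sum_neg_distrib]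
  refine Finset.sum_congr rfl fun s _ ↦ ?_
  rw [smul_smul, ← neg_smul]
  congr 1
  ring

include hX0 hN hgg₀ hXX0 hlr₀ hXXg hCC hC hcd hdc hqm in
/-- **`[Δ_*[Θ], Π_{Θ^{[g−1]}}] = H_X` for `Θ^{[g]} = [pt_X]`** (principal case, `D = 1`): `(L, Λ, H) = (Δ_*[Θ], Π_{Θ^{[g−1]}}, H_X)` satisfies `[L, Λ] = H` on the nose on
`Hdg•(X × X, ℤ)` (g34-#6 §4 in the grading form). [cite: Huybrechts2005, §1.2 Def. 1.2.25 and Prop. 1.2.26 (p0047 L7–L19)] [cite: Moonen2011ChowMotiveAbelianSchemes, §5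
(p0015 L2–L5)] -/
theorem integralHodgeClassesCorrComp_pushforward_diagHom_pontryaginCorrespondence_nsDivPower_sub_eq_kunnethGrading
    (hΘ : nsDivPower X Θ gX = pointIntegralHodgeClass X eX) :
    integralHodgeClassesPushforward K₂ gX (liftHom (fstHom X (prodObj X X)) (sndHom X (prodObj X X) ≫ sndHom X X)) eT eXX h3₂ hgT h3₂' hgXX
      (integralHodgeClassesCup (prodObj X (prodObj X X)).toIsog.Φ hK₂
        (integralHodgeClassesPullbackHom (liftHom (fstHom X (prodObj X X)) (sndHom X (prodObj X X) ≫ fstHom X X)) d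
          (integralHodgeClassesPushforward d d (liftHom (fstHom X X) (fstHom X X + sndHom X X)) eXX eXX hq hgXX hq hgXX
            (integralHodgeClassesPullbackHom (sndHom X X) d (nsDivPower X Θ d))))
        (integralHodgeClassesPullbackHom (sndHom X (prodObj X X)) c₁
          (integralHodgeClassesPushforward 1 c₁ (diagHom X) eX eXX hl hgX hl' hgXX (neronSeveriGroupEquiv X.toIsog.Φ Θ)))) -
      integralHodgeClassesPushforward K₁ gX (liftHom (fstHom X (prodObj X X)) (sndHom X (prodObj X X) ≫ sndHom X X)) eT eXX h3₁ hgT h3₁' hgXX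
        (integralHodgeClassesCup (prodObj X (prodObj X X)).toIsog.Φ hK₁
          (integralHodgeClassesPullbackHom (liftHom (fstHom X (prodObj X X)) (sndHom X (prodObj X X) ≫ fstHom X X)) c₁
            (integralHodgeClassesPushforward 1 c₁ (diagHom X) eX eXX hl hgX hl' hgXX (neronSeveriGroupEquiv X.toIsog.Φ Θ)))
          (integralHodgeClassesPullbackHom (sndHom X (prodObj X X)) d
            (integralHodgeClassesPushforward d d (liftHom (fstHom X X) (fstHom X X + sndHom X X)) eXX eXX hq hgXX hq hgXX
              (integralHodgeClassesPullbackHom (sndHom X X) d (nsDivPower X Θ d))))) =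
      kunnethGrading X eX eXX hX0 hgX hcX hgXX := by
  rw [integralHodgeClassesCorrComp_pushforward_diagHom_pontryaginCorrespondence_nsDivPower_sub_eq_zsmul_kunnethGrading X eX eXX eT hX0 hgX hcX hgXX hgT hN hgg₀ hXX0
      hlr₀ hXXg hCC hC hl hl' hq hK₁ h3₁ h3₁' hcd hdc hK₂ h3₂ h3₂' hqm Θ 1 (by rw [hΘ, one_smul]), one_smul]

variable {θ : neronSeveriGroup X.toIsog.Φ} {t : Fin gX → ℕ}
  (hθ : IsRiemannForm X.toIsog.Φ (θ : X.toIsog.E [⋀^Fin 2]→L[ℝ] ℝ)) (ht : IsPolarizationType X.toIsog.Φ (θ : X.toIsog.E [⋀^Fin 2]→L[ℝ] ℝ) t)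

include hX0 hN hgg₀ hXX0 hlr₀ hXXg hCC hC hcd hdc hqm hθ ht in
/-- **`[Δ_*[Θ], Π_{Θ^{[g−1]}}] = (d₁⋯d_g) · H_X` for a polarized complex torus `(X, θ)` of type `(d₁, …, d_g)`, `Θ = −θ = c₁(L)`.**
[cite: Huybrechts2005, §1.2 Def. 1.2.25 and Prop. 1.2.26 (p0047 L7–L19)] [cite: Moonen2011ChowMotiveAbelianSchemes, §5 (p0015 L2–L5)]
[cite: Lange2023AbelianVarietiesComplex, §1.7.2 Thm. 1.7.3 (p0072 L21–L23) and §6.3.4 Thm. 6.3.12 (p0320 L1–L7)] -/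
theorem integralHodgeClassesCorrComp_pushforward_diagHom_pontryaginCorrespondence_nsDivPower_sub_eq_zsmul_kunnethGrading_of_isPolarizationType :
    integralHodgeClassesPushforward K₂ gX (liftHom (fstHom X (prodObj X X)) (sndHom X (prodObj X X) ≫ sndHom X X)) eT eXX h3₂ hgT h3₂' hgXX
      (integralHodgeClassesCup (prodObj X (prodObj X X)).toIsog.Φ hK₂
        (integralHodgeClassesPullbackHom (liftHom (fstHom X (prodObj X X)) (sndHom X (prodObj X X) ≫ fstHom X X)) d
          (integralHodgeClassesPushforward d d (liftHom (fstHom X X) (fstHom X X + sndHom X X)) eXX eXX hq hgXX hq hgXX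
            (integralHodgeClassesPullbackHom (sndHom X X) d (nsDivPower X (-θ) d))))
        (integralHodgeClassesPullbackHom (sndHom X (prodObj X X)) c₁
          (integralHodgeClassesPushforward 1 c₁ (diagHom X) eX eXX hl hgX hl' hgXX (neronSeveriGroupEquiv X.toIsog.Φ (-θ))))) -
      integralHodgeClassesPushforward K₁ gX (liftHom (fstHom X (prodObj X X)) (sndHom X (prodObj X X) ≫ sndHom X X)) eT eXX h3₁ hgT h3₁' hgXX
        (integralHodgeClassesCup (prodObj X (prodObj X X)).toIsog.Φ hK₁
          (integralHodgeClassesPullbackHom (liftHom (fstHom X (prodObj X X)) (sndHom X (prodObj X X) ≫ fstHom X X)) c₁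
            (integralHodgeClassesPushforward 1 c₁ (diagHom X) eX eXX hl hgX hl' hgXX (neronSeveriGroupEquiv X.toIsog.Φ (-θ))))
          (integralHodgeClassesPullbackHom (sndHom X (prodObj X X)) d
            (integralHodgeClassesPushforward d d (liftHom (fstHom X X) (fstHom X X + sndHom X X)) eXX eXX hq hgXX hq hgXX
              (integralHodgeClassesPullbackHom (sndHom X X) d (nsDivPower X (-θ) d))))) =
      (∏ i, (t i : ℤ)) • kunnethGrading X eX eXX hX0 hgX hcX hgXX :=
  integralHodgeClassesCorrComp_pushforward_diagHom_pontryaginCorrespondence_nsDivPower_sub_eq_zsmul_kunnethGrading X eX eXX eT hX0 hgX hcX hgXX hgT hN hgg₀ hXX0 hlr₀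
    hXXg hCC hC hl hl' hq hK₁ h3₁ h3₁' hcd hdc hK₂ h3₂ h3₂' hqm (-θ) _ (nsDivPower_neg_top_eq_zsmul_pointIntegralHodgeClass_of_isPolarizationType X eX hθ ht)

end Grading

end ComplexTorusCat

end Literature.AlgebraicGeometry.HodgeTheory
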